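import Summits.QuantumFields.YangMills.Theorems.BalabanUVNodesN12FlatChartDerivIterLin
import Summits.QuantumFields.YangMills.Theorems.BalabanUVNodesN12GuardedChartDerivQLinJunction
import Summits.QuantumFields.YangMills.Theorems.UnitScaleTiltProp8ChartHInvComb
import Literature.MathematicalPhysics.QuantumFieldTheory.Balaban1983to89.B14Eq213DetSet
import Literature.MathematicalPhysics.QuantumFieldTheory.Balaban1983to89.Node00.LinearisedAveragingFlat
import HarnessLib

/-!
# BalabanUVNodes ∕ N12 — (J-b) module H10: EVERY RIGHT INVERSE OF THE MULTI-SCALE CONSTRAINT IS THE IDENTITY PLACEMENT OF THE LEVEL-0 DATUM OFF `Ω₁` —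
# the support clause (gN4) asked by dag-n12-w4 g4 (INBOX 2026-08-28 l.38130 ∕ l.37661) holds for ANY right inverse, linear or not, with `S_H = {b | b₋ ∈ Ω₁ ∧ b₊ ∈ Ω₁}`

Cell `pub-ymgap` (HUMAN RULINGS D-0062 ∕ D-0149), width seat `pub-ymgap-dag-n10-w1` g5 (modules A–E g0, F∕F′∕G1∕G2 g2, H1a–H3 g3, H4–H7 g4, H8∕H8b∕H9 g5 of this lineage).  `--kind proof --supports
stmt-QuantumFields-27364 --as helper` (K1⁹, KEY MAP v2); count-neutral; THEOREMS ONLY (0 `def`, 0 `sorry`, 0 `instance`, 0 `notation`).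

THE OBSERVATION ([III] (2.2) with (2.11): `Γ₀ = Ω₁ᶜ` and `M⁰ = id`).  In the determining set `𝐁 = {Γ_j}` of a nested sequence (r12's `genSet Ω k`, in particular the record's
`Bj M₁ Z k = 𝐁_k(Z)`, `k ≥ 1`) the level-0 member is EVERYTHING OUTSIDE `Ω₁`, and the level-0 constraint is the identity: the rows `(0, c)`, `c ∈ bondsOf Γ₀` = every fine bond with an
end-point outside `Ω₁`, read `Y(c) = X(0, c)`.  Hence ANY map `H` with the right-inverse property — NODE 00's `qLin j U₀ (H X) c = X(j,c)` on `ConstrSet 𝐁 k` at ANY unitary background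
`U₀` (§1–§2), or J-C's chart form `DΦ♭(0)(H y) = y` for `Φ♭ = msChart … (M˙1) 1` (§3, via module B), or the guarded chart `DΦ_U(0)` with datum `M˙U` (§4, via module E) — satisfies `(H X)(c) = X(0, c)` at every bond `c` with `c₋ ∉ Ω₁ ∨ c₊ ∉ Ω₁`.
So: `supp (H X − ext₀ X) ⊆ S_H := {b | b₋ ∈ Ω₁ ∧ b₊ ∈ Ω₁}`, and for data WITHOUT level-0 components `supp (H X) ⊆ S_H ⊆ {b | b₋ ∈ Ω₁} ⊆ inputsPos 𝐁 ∪ {b | b₋ ∈ Ω₁}` — the clause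
(gN4) of dag-n12-w4's (μ)_N ∕ (χ)_N road, for my g3 `H` (`exists_flat_rightInverse_enum_Bj`, `exists_rightInverse_fderiv_msChart_Bj_one`) and for everybody else's.  No re-run of
the H1a–H2b construction is needed (its finer support information — lifts on bonds with both end blocks inside the towers, comb correction at centres in `Ω_j` — is not exported here).

CONSUMED BY NAME, nothing modified: NODE 00 `LinearisedAveragingAtBackground` (`qLin_apply`, `iterM_zero`, `dIterL_zero`, `coeField_apply`), `MultiScaleFibreChart` (`ConstrSet`, `constrEnum`),
module B `…N12FlatChartDerivIterLin.iterLin_eq_of_rightInverse`, UST `ChartHInv(Comb).exists_linFamily`, r12 `B15DeterminingSets` (`bondsOf`, `genSet`, `gammaRegion_zero`, `pts_zero`),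
r11 `B14.Eq213DetSet.Bj_zero`, Mathlib `Unitary.star_mul_self_of_mem`.

CONTENTS (ns `Summit.QuantumFields.YangMills.BalabanUVNodes.N12RightInverseLevelZeroLocality`).  §1 `qLin_level_zero` (`qLin 0 U₀ X c = X c`, `U₀` unitary), `mem_bondsOf_genSet_zero`,
`mem_bondsOf_Bj_zero`.  §2 (ConstrSet ∕ `qLin` shape, any `U₀`, any right inverse) ★★ `rightInverse_apply_of_mem_zero`, ★★★ `rightInverse_apply_off_Bj` (identity placement off `Ω₁`), ★★★ `rightInverse_dichotomy_Bj` («property (3)»),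
★★★ `rightInverse_support_Bj` (`X(0,·) = 0 ⟹ supp (H X) ⊆ {b₋ ∈ Ω₁ ∧ b₊ ∈ Ω₁}`), `rightInverse_exists_support_Bj` (the `∃ S_H` shape of the ask).  §3 (chart shape at the flat datum,
module B) ★★ `chartRightInverse_apply_of_mem_zero`, ★★★ `chartRightInverse_apply_off_Bj`, ★★★ `chartRightInverse_dichotomy_Bj`, ★★★ `chartRightInverse_support_Bj`, `chartRightInverse_exists_support_Bj`.  §4 (chart shape at a GUARDED background `U`
with its own datum `M˙U`, module E `fderiv_msChart_apply_eq_suProj_qLin`) ★★ `guardedChartRightInverse_apply_of_mem_zero`, ★★★ `guardedChartRightInverse_apply_off_Bj`,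
★★★ `guardedChartRightInverse_dichotomy_Bj`, ★★★ `guardedChartRightInverse_support_Bj` — covers module F ∕ H3's `exists_radius_rightInverse_fderiv_msChart_Bj` (`H₁ ∘ G` at every guarded near-flat `U₀`).

HONEST FRAMING.  Bookkeeping of the level-0 rows of [III] (2.2)∕(2.11) on the tree's own determining sets; no estimate; nothing of Bałaban's asserted; the guarded chart (module F's `U₀ ≠ 1`
with `W = M˙U₀`) is §4; a general datum `W` with `U₀` on its fibre reduces to §4 by n12-w4's `msChart_eq_msChart_avgFamily_of_agreeOn` (not re-typed here); N12 ∕ N10 NOT discharged; K1⁹ NOT closed;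
count-neutral (typed 28∕28 · discharged 5∕27 unmoved); one finite 𝕋⁴ programme at fixed ε — R4 closes the conditional finite-𝕋⁴ rung `BalabanLadder.UV` only; the YM mass gap (Clay) is
NOT proved by any of this; nothing continuum ∕ ℝ⁴ ∕ OS.
-/

noncomputable section
open scoped BigOperators
namespace Summit.QuantumFields.YangMills.BalabanUVNodes.N12RightInverseLevelZeroLocality

open Literature.MathematicalPhysics.QuantumFieldTheory.Balaban1983to89
open T4Continuum (T4Family)
open BlockAveragingEMLLinearised (linAvg)
open T4AdjointCovarianceUnitary (lieSU)
open B15DeterminingSets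
open B14.Eq213DetSet (Bj maxDomT Bj_zero)
open Node00
open Summit.QuantumFields.YangMills.Theorems.ChartHInv (exists_linFamily)
open Summit.QuantumFields.YangMills.BalabanUVNodes.N12FlatChartDerivIterLin (iterLin_eq_of_rightInverse)
open ExpMeanLog (deltaSU)
open Summit.QuantumFields.YangMills.Theorems.BlockAvgCorrector (stokesConst)
open Summit.QuantumFields.YangMills.BalabanUVNodes.N12GuardedChartDerivQLinJunction (fderiv_msChart_apply_eq_suProj_qLin)

/-! ## §1  The level-0 row is the identity; the level-0 member of `𝐁` is everything outside `Ω₁` -/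

section LevelZero

variable {P : Params} {N : ℕ}

/-- **`Q⁰ = id` at any unitary background**: `qLin 0 U₀ X c = U₀(c)⋆·(U₀(c)·X(c)) = X(c)` ([III] (2.11) with `M⁰ = id`; NODE 00's `iterM_zero`, `dIterL_zero`).
[cite: Balaban1988Convergent, (2.11) p.256] -/
theorem qLin_level_zero (U₀ : GaugeField P 0 (SU N)) (X : PBond P 0 → lieSU (Fin N)) (c : PBond P 0) :
    qLin 0 U₀ X c = (X c : Matrix (Fin N) (Fin N) ℂ) := by
  simp only [qLin_apply, iterM_zero, dIterL_zero, ContinuousLinearMap.coe_id', id, coeField_apply]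
  rw [← mul_assoc, Unitary.star_mul_self_of_mem (Matrix.specialUnitaryGroup_le_unitaryGroup (U₀ c).2), one_mul]

/-- **THE LEVEL-0 ROWS OF `genSet Ω k` (`k ≥ 1`) ARE THE BONDS WITH AN END-POINT OUTSIDE `Ω₁`** (`Γ₀ = Ω₁ᶜ`, [III] (2.2)). [cite: Balaban1988Convergent, (2.2) p.255] -/
theorem mem_bondsOf_genSet_zero (Ω : ℕ → Set (Site P 0)) {k : ℕ} (hk : 0 < k) (c : PBond P 0) :
    c ∈ bondsOf (genSet Ω k 0) ↔ (c.src ∉ Ω 1 ∨ c.tgt ∉ Ω 1) := by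
  have h0 : genSet Ω k 0 = (Ω 1)ᶜ := by
    show pts 0 (gammaRegion Ω k 0) = (Ω 1)ᶜ
    rw [gammaRegion_zero Ω hk, pts_zero]
  rw [h0]
  rfl

/-- The same at the record's `𝐁_k(Z) = Bj M₁ Z k` (`k ≥ 1`): level-0 rows = bonds with an end-point outside `Ω₁ = maxDomT M₁ Z 1`. [cite: Balaban1988Convergent, (2.13) pp.256-257, (2.2) p.255] -/
theorem mem_bondsOf_Bj_zero {M₁ k : ℕ} (hk : 0 < k) (Z : Set (Site P 0)) (c : PBond P 0) :
    c ∈ bondsOf ((Bj M₁ Z k : DetSet P) 0) ↔ (c.src ∉ maxDomT M₁ Z 1 ∨ c.tgt ∉ maxDomT M₁ Z 1) := by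
  rw [Bj_zero hk]
  rfl

end LevelZero

/-! ## §2  ConstrSet ∕ `qLin` shape: every right inverse places the level-0 datum identically -/

section ConstrShape

variable {P : Params} {N : ℕ}

/-- ★★ **EVERY RIGHT INVERSE IS THE IDENTITY ON THE LEVEL-0 ROWS**: if `qLin j U₀ (H X) c = X(j,c)` on `ConstrSet 𝐁 k` (any unitary `U₀`, any map `H`) then `(H X)(c) = X(0,c)` at every
`c ∈ bondsOf (𝐁 0)`. [cite: Balaban1988Convergent, (2.11) p.256; Balaban1985Variational, (45) p.285] -/
theorem rightInverse_apply_of_mem_zero {𝔹 : DetSet P} {k : ℕ} (U₀ : GaugeField P 0 (SU N))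
    (H : (ConstrSet 𝔹 k → lieSU (Fin N)) → (PBond P 0 → lieSU (Fin N)))
    (hH : ∀ (X : ConstrSet 𝔹 k → lieSU (Fin N)) (idx : ConstrSet 𝔹 k), qLin (idx.1 : ℕ) U₀ (H X) idx.2.1 = (X idx : Matrix (Fin N) (Fin N) ℂ))
    (X : ConstrSet 𝔹 k → lieSU (Fin N)) {c : PBond P 0} (hc : c ∈ bondsOf (𝔹 0)) :
    H X c = X ⟨⟨0, Nat.succ_pos k⟩, c, hc⟩ := by
  have h := hH X ⟨⟨0, Nat.succ_pos k⟩, c, hc⟩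
  exact Subtype.ext ((qLin_level_zero U₀ (H X) c).symm.trans h)

/-- ★★★ **OFF `Ω₁` EVERY RIGHT INVERSE AT `𝐁_k(Z)` IS THE IDENTITY PLACEMENT OF THE LEVEL-0 DATUM** (`k ≥ 1`): `c₋ ∉ Ω₁ ∨ c₊ ∉ Ω₁ ⟹ (H X)(c) = X(0,c)`.
[cite: Balaban1988Convergent, (2.2) p.255, (2.11) p.256, (2.13) pp.256-257] -/
theorem rightInverse_apply_off_Bj {M₁ k : ℕ} (hk : 0 < k) {Z : Set (Site P 0)} (U₀ : GaugeField P 0 (SU N))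
    (H : (ConstrSet (Bj M₁ Z k : DetSet P) k → lieSU (Fin N)) → (PBond P 0 → lieSU (Fin N)))
    (hH : ∀ (X : ConstrSet (Bj M₁ Z k : DetSet P) k → lieSU (Fin N)) (idx : ConstrSet (Bj M₁ Z k : DetSet P) k),
      qLin (idx.1 : ℕ) U₀ (H X) idx.2.1 = (X idx : Matrix (Fin N) (Fin N) ℂ))
    (X : ConstrSet (Bj M₁ Z k : DetSet P) k → lieSU (Fin N)) (c : PBond P 0) (hc : c.src ∉ maxDomT M₁ Z 1 ∨ c.tgt ∉ maxDomT M₁ Z 1) :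
    H X c = X ⟨⟨0, Nat.succ_pos k⟩, c, (mem_bondsOf_Bj_zero hk Z c).2 hc⟩ :=
  rightInverse_apply_of_mem_zero U₀ H hH X _

/-- ★★★ **THE DICHOTOMY (dag-n12-w4's «property (3)», for EVERY right inverse)**: each fine bond `c` either has BOTH end-points in `Ω₁`, or is a level-0 row on which `H` is the identity
placement of the datum: `(c₋ ∈ Ω₁ ∧ c₊ ∈ Ω₁) ∨ ∃ hc, H X c = X ⟨0, c, hc⟩`. [cite: Balaban1988Convergent, (2.2) p.255, (2.11) p.256, (2.13) pp.256-257] -/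
theorem rightInverse_dichotomy_Bj {M₁ k : ℕ} (hk : 0 < k) {Z : Set (Site P 0)} (U₀ : GaugeField P 0 (SU N))
    (H : (ConstrSet (Bj M₁ Z k : DetSet P) k → lieSU (Fin N)) → (PBond P 0 → lieSU (Fin N)))
    (hH : ∀ (X : ConstrSet (Bj M₁ Z k : DetSet P) k → lieSU (Fin N)) (idx : ConstrSet (Bj M₁ Z k : DetSet P) k),
      qLin (idx.1 : ℕ) U₀ (H X) idx.2.1 = (X idx : Matrix (Fin N) (Fin N) ℂ))
    (X : ConstrSet (Bj M₁ Z k : DetSet P) k → lieSU (Fin N)) (c : PBond P 0) :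
    (c.src ∈ maxDomT M₁ Z 1 ∧ c.tgt ∈ maxDomT M₁ Z 1) ∨
      ∃ hc : c ∈ bondsOf ((Bj M₁ Z k : DetSet P) 0), H X c = X ⟨⟨0, Nat.succ_pos k⟩, c, hc⟩ := by
  by_cases h : c.src ∈ maxDomT M₁ Z 1 ∧ c.tgt ∈ maxDomT M₁ Z 1
  · exact Or.inl h
  · have h' : c.src ∉ maxDomT M₁ Z 1 ∨ c.tgt ∉ maxDomT M₁ Z 1 := by tauto
    exact Or.inr ⟨(mem_bondsOf_Bj_zero hk Z c).2 h', rightInverse_apply_off_Bj hk U₀ H hH X c h'⟩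

/-- ★★★ **THE SUPPORT CLAUSE (gN4) FOR EVERY RIGHT INVERSE AT `𝐁_k(Z)`**: for data with no level-0 component, `(H X)(c) ≠ 0 ⟹ c₋ ∈ Ω₁ ∧ c₊ ∈ Ω₁` — `supp (H X) ⊆ {b | b₋ ∈ Ω₁ ∧ b₊ ∈ Ω₁}
⊆ inputsPos 𝐁 ∪ {b | b₋ ∈ Ω₁}` (dag-n12-w4's phrasing). [cite: Balaban1988Convergent, (2.2) p.255, (2.11) p.256, (2.13) pp.256-257] -/
theorem rightInverse_support_Bj {M₁ k : ℕ} (hk : 0 < k) {Z : Set (Site P 0)} (U₀ : GaugeField P 0 (SU N))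
    (H : (ConstrSet (Bj M₁ Z k : DetSet P) k → lieSU (Fin N)) → (PBond P 0 → lieSU (Fin N)))
    (hH : ∀ (X : ConstrSet (Bj M₁ Z k : DetSet P) k → lieSU (Fin N)) (idx : ConstrSet (Bj M₁ Z k : DetSet P) k),
      qLin (idx.1 : ℕ) U₀ (H X) idx.2.1 = (X idx : Matrix (Fin N) (Fin N) ℂ))
    (X : ConstrSet (Bj M₁ Z k : DetSet P) k → lieSU (Fin N))
    (hX0 : ∀ (c : PBond P 0) (hc : c ∈ bondsOf ((Bj M₁ Z k : DetSet P) 0)), X ⟨⟨0, Nat.succ_pos k⟩, c, hc⟩ = 0)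
    (c : PBond P 0) (hc : H X c ≠ 0) : c.src ∈ maxDomT M₁ Z 1 ∧ c.tgt ∈ maxDomT M₁ Z 1 := by
  by_contra h
  have h' : c.src ∉ maxDomT M₁ Z 1 ∨ c.tgt ∉ maxDomT M₁ Z 1 := by tauto
  exact hc ((rightInverse_apply_off_Bj hk U₀ H hH X c h').trans (hX0 c _))

/-- The `∃ S_H` shape of the ask: ONE set `S_H ⊆ {b | b₋ ∈ Ω₁ ∧ b₊ ∈ Ω₁}` off which `H X` vanishes for every datum `X` without level-0 component.
[cite: Balaban1988Convergent, (2.2) p.255, (2.11) p.256] -/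
theorem rightInverse_exists_support_Bj {M₁ k : ℕ} (hk : 0 < k) {Z : Set (Site P 0)} (U₀ : GaugeField P 0 (SU N))
    (H : (ConstrSet (Bj M₁ Z k : DetSet P) k → lieSU (Fin N)) → (PBond P 0 → lieSU (Fin N)))
    (hH : ∀ (X : ConstrSet (Bj M₁ Z k : DetSet P) k → lieSU (Fin N)) (idx : ConstrSet (Bj M₁ Z k : DetSet P) k),
      qLin (idx.1 : ℕ) U₀ (H X) idx.2.1 = (X idx : Matrix (Fin N) (Fin N) ℂ)) :
    ∃ S : Set (PBond P 0), S ⊆ {b | b.src ∈ maxDomT M₁ Z 1 ∧ b.tgt ∈ maxDomT M₁ Z 1} ∧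
      ∀ X : ConstrSet (Bj M₁ Z k : DetSet P) k → lieSU (Fin N),
        (∀ (c : PBond P 0) (hc : c ∈ bondsOf ((Bj M₁ Z k : DetSet P) 0)), X ⟨⟨0, Nat.succ_pos k⟩, c, hc⟩ = 0) → ∀ b ∉ S, H X b = 0 :=
  ⟨{b | b.src ∈ maxDomT M₁ Z 1 ∧ b.tgt ∈ maxDomT M₁ Z 1}, le_rfl, fun X hX0 b hb => by
    by_contra h
    exact hb (rightInverse_support_Bj hk U₀ H hH X hX0 b h)⟩

end ConstrShape

/-! ## §3  Chart shape at the flat datum (J-C's `Lf := DΦ♭(0)`, module B): the same for `H : (Fin (constrCard 𝐁 k) → 𝔰𝔲(N)) → fields` -/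

section ChartShape

variable {F : T4Family} {N : ℕ} [NeZero N] {K k : ℕ}

/-- ★★ **EVERY RIGHT INVERSE OF `DΦ♭(0)` IS THE IDENTITY ON THE LEVEL-0 ROWS**: `DΦ♭(0)(H y) = y` for all `y` (`Φ♭ = msChart F N K k 𝐁 (M˙1) 1`) ⟹ `(H y)(c) = y(i₀(c))` at every `c ∈ bondsOf (𝐁 0)`,
`i₀(c) = constrEnum 𝐁 k (0, c)` (module B: the rows of `DΦ♭(0)` are `π ∘ Q^{(j)}`, `Q^{(0)} = id`). [cite: Balaban1988Convergent, (2.11) p.256; Balaban1985Variational, (45) p.285] -/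
theorem chartRightInverse_apply_of_mem_zero (𝔹 : DetSet (F.P K)) (H : (Fin (constrCard 𝔹 k) → lieSU (Fin N)) → PBond (F.P K) 0 → lieSU (Fin N))
    (hH : ∀ y, fderiv ℝ (msChart F N K k 𝔹 (avgFamily (avOfRecord F N K) (1 : GaugeField (F.P K) 0 (SU N))) (1 : GaugeField (F.P K) 0 (SU N))) 0 (H y) = y)
    (y : Fin (constrCard 𝔹 k) → lieSU (Fin N)) {c : PBond (F.P K) 0} (hc : c ∈ bondsOf (𝔹 0)) :
    H y c = y (constrEnum 𝔹 k ⟨⟨0, Nat.succ_pos k⟩, c, hc⟩) := by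
  obtain ⟨Q, hQ0, hQs⟩ := exists_linFamily (P := F.P K) (n := Fin N)
  have h := iterLin_eq_of_rightInverse Q hQ0 hQs 𝔹 H hH y (constrEnum 𝔹 k ⟨⟨0, Nat.succ_pos k⟩, c, hc⟩)
  rw [Equiv.symm_apply_apply] at h
  exact Subtype.ext (by simpa [hQ0] using h)

/-- ★★★ **OFF `Ω₁` EVERY RIGHT INVERSE OF `DΦ♭(0)` AT `𝐁_k(Z)` IS THE IDENTITY PLACEMENT OF THE LEVEL-0 DATUM** (`k ≥ 1`) — in particular my g3 `exists_rightInverse_fderiv_msChart_Bj_one` ∕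
`exists_flat_rightInverse_enum_Bj`'s `H`, but also any other. [cite: Balaban1988Convergent, (2.2) p.255, (2.11) p.256, (2.13) pp.256-257] -/
theorem chartRightInverse_apply_off_Bj {M₁ : ℕ} (hk : 0 < k) {Z : Set (Site (F.P K) 0)}
    (H : (Fin (constrCard (Bj M₁ Z k : DetSet (F.P K)) k) → lieSU (Fin N)) → PBond (F.P K) 0 → lieSU (Fin N))
    (hH : ∀ y, fderiv ℝ (msChart F N K k (Bj M₁ Z k) (avgFamily (avOfRecord F N K) (1 : GaugeField (F.P K) 0 (SU N))) (1 : GaugeField (F.P K) 0 (SU N))) 0 (H y) = y)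
    (y : Fin (constrCard (Bj M₁ Z k : DetSet (F.P K)) k) → lieSU (Fin N)) (c : PBond (F.P K) 0) (hc : c.src ∉ maxDomT M₁ Z 1 ∨ c.tgt ∉ maxDomT M₁ Z 1) :
    H y c = y (constrEnum (Bj M₁ Z k : DetSet (F.P K)) k ⟨⟨0, Nat.succ_pos k⟩, c, (mem_bondsOf_Bj_zero hk Z c).2 hc⟩) :=
  chartRightInverse_apply_of_mem_zero _ H hH y _

/-- ★★★ **THE DICHOTOMY FOR EVERY RIGHT INVERSE OF `DΦ♭(0)` AT `𝐁_k(Z)`** (dag-n12-w4's «property (3)», chart form): `(c₋ ∈ Ω₁ ∧ c₊ ∈ Ω₁) ∨ ∃ hc, H y c = y(i₀(c))`.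
[cite: Balaban1988Convergent, (2.2) p.255, (2.11) p.256, (2.13) pp.256-257] -/
theorem chartRightInverse_dichotomy_Bj {M₁ : ℕ} (hk : 0 < k) {Z : Set (Site (F.P K) 0)}
    (H : (Fin (constrCard (Bj M₁ Z k : DetSet (F.P K)) k) → lieSU (Fin N)) → PBond (F.P K) 0 → lieSU (Fin N))
    (hH : ∀ y, fderiv ℝ (msChart F N K k (Bj M₁ Z k) (avgFamily (avOfRecord F N K) (1 : GaugeField (F.P K) 0 (SU N))) (1 : GaugeField (F.P K) 0 (SU N))) 0 (H y) = y)
    (y : Fin (constrCard (Bj M₁ Z k : DetSet (F.P K)) k) → lieSU (Fin N)) (c : PBond (F.P K) 0) :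
    (c.src ∈ maxDomT M₁ Z 1 ∧ c.tgt ∈ maxDomT M₁ Z 1) ∨
      ∃ hc : c ∈ bondsOf ((Bj M₁ Z k : DetSet (F.P K)) 0), H y c = y (constrEnum (Bj M₁ Z k : DetSet (F.P K)) k ⟨⟨0, Nat.succ_pos k⟩, c, hc⟩) := by
  by_cases h : c.src ∈ maxDomT M₁ Z 1 ∧ c.tgt ∈ maxDomT M₁ Z 1
  · exact Or.inl h
  · have h' : c.src ∉ maxDomT M₁ Z 1 ∨ c.tgt ∉ maxDomT M₁ Z 1 := by tauto
    exact Or.inr ⟨(mem_bondsOf_Bj_zero hk Z c).2 h', chartRightInverse_apply_off_Bj hk H hH y c h'⟩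

/-- ★★★ **THE SUPPORT CLAUSE (gN4) FOR EVERY RIGHT INVERSE OF `DΦ♭(0)` AT `𝐁_k(Z)`**: for chart data `y` vanishing on the level-0 rows, `(H y)(c) ≠ 0 ⟹ c₋ ∈ Ω₁ ∧ c₊ ∈ Ω₁`.
[cite: Balaban1988Convergent, (2.2) p.255, (2.11) p.256, (2.13) pp.256-257] -/
theorem chartRightInverse_support_Bj {M₁ : ℕ} (hk : 0 < k) {Z : Set (Site (F.P K) 0)}
    (H : (Fin (constrCard (Bj M₁ Z k : DetSet (F.P K)) k) → lieSU (Fin N)) → PBond (F.P K) 0 → lieSU (Fin N))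
    (hH : ∀ y, fderiv ℝ (msChart F N K k (Bj M₁ Z k) (avgFamily (avOfRecord F N K) (1 : GaugeField (F.P K) 0 (SU N))) (1 : GaugeField (F.P K) 0 (SU N))) 0 (H y) = y)
    (y : Fin (constrCard (Bj M₁ Z k : DetSet (F.P K)) k) → lieSU (Fin N))
    (hy0 : ∀ (c : PBond (F.P K) 0) (hc : c ∈ bondsOf ((Bj M₁ Z k : DetSet (F.P K)) 0)), y (constrEnum (Bj M₁ Z k : DetSet (F.P K)) k ⟨⟨0, Nat.succ_pos k⟩, c, hc⟩) = 0)
    (c : PBond (F.P K) 0) (hc : H y c ≠ 0) : c.src ∈ maxDomT M₁ Z 1 ∧ c.tgt ∈ maxDomT M₁ Z 1 := by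
  by_contra h
  have h' : c.src ∉ maxDomT M₁ Z 1 ∨ c.tgt ∉ maxDomT M₁ Z 1 := by tauto
  exact hc ((chartRightInverse_apply_off_Bj hk H hH y c h').trans (hy0 c _))

/-- The `∃ S_H` shape of dag-n12-w4's ask for the chart form: ONE set `S_H ⊆ {b | b₋ ∈ Ω₁ ∧ b₊ ∈ Ω₁}` off which `H y` vanishes for every `y` without level-0 component.
[cite: Balaban1988Convergent, (2.2) p.255, (2.11) p.256] -/
theorem chartRightInverse_exists_support_Bj {M₁ : ℕ} (hk : 0 < k) {Z : Set (Site (F.P K) 0)}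
    (H : (Fin (constrCard (Bj M₁ Z k : DetSet (F.P K)) k) → lieSU (Fin N)) → PBond (F.P K) 0 → lieSU (Fin N))
    (hH : ∀ y, fderiv ℝ (msChart F N K k (Bj M₁ Z k) (avgFamily (avOfRecord F N K) (1 : GaugeField (F.P K) 0 (SU N))) (1 : GaugeField (F.P K) 0 (SU N))) 0 (H y) = y) :
    ∃ S : Set (PBond (F.P K) 0), S ⊆ {b | b.src ∈ maxDomT M₁ Z 1 ∧ b.tgt ∈ maxDomT M₁ Z 1} ∧
      ∀ y : Fin (constrCard (Bj M₁ Z k : DetSet (F.P K)) k) → lieSU (Fin N),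
        (∀ (c : PBond (F.P K) 0) (hc : c ∈ bondsOf ((Bj M₁ Z k : DetSet (F.P K)) 0)), y (constrEnum (Bj M₁ Z k : DetSet (F.P K)) k ⟨⟨0, Nat.succ_pos k⟩, c, hc⟩) = 0) →
        ∀ b ∉ S, H y b = 0 :=
  ⟨{b | b.src ∈ maxDomT M₁ Z 1 ∧ b.tgt ∈ maxDomT M₁ Z 1}, le_rfl, fun y hy0 b hb => by
    by_contra h
    exact hb (chartRightInverse_support_Bj hk H hH y hy0 b h)⟩

end ChartShape

/-! ## §4  Chart shape at a GUARDED background `U` with its own datum `M˙U` (module F ∕ H3's `exists_radius_rightInverse_fderiv_msChart_Bj`, module E): the same -/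

section GuardedChartShape

variable {F : T4Family} {N : ℕ} [NeZero N] {K k : ℕ}

/-- ★★ **EVERY RIGHT INVERSE OF `DΦ_U(0)` IS THE IDENTITY ON THE LEVEL-0 ROWS**, `Φ_U = msChart F N K k 𝐁 (M˙U) U` at a configuration `U` on 35e's plaquette guard below `k` (module E: the rows of
`DΦ_U(0)` are `π ∘ qLin j U`, and `qLin 0 U = id` by §1). [cite: Balaban1988Convergent, (2.11) p.256; Balaban1985Variational, (45) p.285, (83) p.290] -/
theorem guardedChartRightInverse_apply_of_mem_zero {t₀ : ℝ} (ht₀ : 0 < t₀) (hstδ : stokesConst (F.P K) * t₀ < deltaSU (Fin N))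
    {U : GaugeField (F.P K) 0 (SU N)} (hsm : ∀ i, i < k → PlaqSmall t₀ (Averaging.iter (avOfRecord F N K) i U))
    (𝔹 : DetSet (F.P K)) (H : (Fin (constrCard 𝔹 k) → lieSU (Fin N)) → PBond (F.P K) 0 → lieSU (Fin N))
    (hH : ∀ y, fderiv ℝ (msChart F N K k 𝔹 (avgFamily (avOfRecord F N K) U) U) 0 (H y) = y)
    (y : Fin (constrCard 𝔹 k) → lieSU (Fin N)) {c : PBond (F.P K) 0} (hc : c ∈ bondsOf (𝔹 0)) :
    H y c = y (constrEnum 𝔹 k ⟨⟨0, Nat.succ_pos k⟩, c, hc⟩) := by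
  have h := congrFun (hH y) (constrEnum 𝔹 k ⟨⟨0, Nat.succ_pos k⟩, c, hc⟩)
  rw [fderiv_msChart_apply_eq_suProj_qLin ht₀ hstδ hsm 𝔹 (H y) _, Equiv.symm_apply_apply] at h
  have h2 : suProj N (qLin 0 U (H y) c) = H y c := by rw [qLin_level_zero, suProj_coe]
  exact h2.symm.trans h

/-- ★★★ **OFF `Ω₁` EVERY RIGHT INVERSE OF `DΦ_U(0)` AT `𝐁_k(Z)` IS THE IDENTITY PLACEMENT OF THE LEVEL-0 DATUM** (guarded `U`, `k ≥ 1`) — in particular the `H₁ ∘ G` of module F ∕ H3's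
`exists_radius_rightInverse_fderiv_msChart_Bj` at every guarded near-flat `U₀`, and (via n12-w4's `msChart_eq_msChart_avgFamily_of_agreeOn`) the `_of_agreeOn` editions for a datum `W` with `U₀`
on its fibre. [cite: Balaban1988Convergent, (2.2) p.255, (2.11) p.256, (2.13) pp.256-257] -/
theorem guardedChartRightInverse_apply_off_Bj {t₀ : ℝ} (ht₀ : 0 < t₀) (hstδ : stokesConst (F.P K) * t₀ < deltaSU (Fin N))
    {U : GaugeField (F.P K) 0 (SU N)} (hsm : ∀ i, i < k → PlaqSmall t₀ (Averaging.iter (avOfRecord F N K) i U))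
    {M₁ : ℕ} (hk : 0 < k) {Z : Set (Site (F.P K) 0)}
    (H : (Fin (constrCard (Bj M₁ Z k : DetSet (F.P K)) k) → lieSU (Fin N)) → PBond (F.P K) 0 → lieSU (Fin N))
    (hH : ∀ y, fderiv ℝ (msChart F N K k (Bj M₁ Z k) (avgFamily (avOfRecord F N K) U) U) 0 (H y) = y)
    (y : Fin (constrCard (Bj M₁ Z k : DetSet (F.P K)) k) → lieSU (Fin N)) (c : PBond (F.P K) 0) (hc : c.src ∉ maxDomT M₁ Z 1 ∨ c.tgt ∉ maxDomT M₁ Z 1) :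
    H y c = y (constrEnum (Bj M₁ Z k : DetSet (F.P K)) k ⟨⟨0, Nat.succ_pos k⟩, c, (mem_bondsOf_Bj_zero hk Z c).2 hc⟩) :=
  guardedChartRightInverse_apply_of_mem_zero ht₀ hstδ hsm _ H hH y _

/-- ★★★ **THE DICHOTOMY FOR EVERY RIGHT INVERSE OF `DΦ_U(0)` AT `𝐁_k(Z)`** (guarded `U`, «property (3)»): `(c₋ ∈ Ω₁ ∧ c₊ ∈ Ω₁) ∨ ∃ hc, H y c = y(i₀(c))`.
[cite: Balaban1988Convergent, (2.2) p.255, (2.11) p.256, (2.13) pp.256-257] -/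
theorem guardedChartRightInverse_dichotomy_Bj {t₀ : ℝ} (ht₀ : 0 < t₀) (hstδ : stokesConst (F.P K) * t₀ < deltaSU (Fin N))
    {U : GaugeField (F.P K) 0 (SU N)} (hsm : ∀ i, i < k → PlaqSmall t₀ (Averaging.iter (avOfRecord F N K) i U))
    {M₁ : ℕ} (hk : 0 < k) {Z : Set (Site (F.P K) 0)}
    (H : (Fin (constrCard (Bj M₁ Z k : DetSet (F.P K)) k) → lieSU (Fin N)) → PBond (F.P K) 0 → lieSU (Fin N))
    (hH : ∀ y, fderiv ℝ (msChart F N K k (Bj M₁ Z k) (avgFamily (avOfRecord F N K) U) U) 0 (H y) = y)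
    (y : Fin (constrCard (Bj M₁ Z k : DetSet (F.P K)) k) → lieSU (Fin N)) (c : PBond (F.P K) 0) :
    (c.src ∈ maxDomT M₁ Z 1 ∧ c.tgt ∈ maxDomT M₁ Z 1) ∨
      ∃ hc : c ∈ bondsOf ((Bj M₁ Z k : DetSet (F.P K)) 0), H y c = y (constrEnum (Bj M₁ Z k : DetSet (F.P K)) k ⟨⟨0, Nat.succ_pos k⟩, c, hc⟩) := by
  by_cases h : c.src ∈ maxDomT M₁ Z 1 ∧ c.tgt ∈ maxDomT M₁ Z 1
  · exact Or.inl h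
  · have h' : c.src ∉ maxDomT M₁ Z 1 ∨ c.tgt ∉ maxDomT M₁ Z 1 := by tauto
    exact Or.inr ⟨(mem_bondsOf_Bj_zero hk Z c).2 h', guardedChartRightInverse_apply_off_Bj ht₀ hstδ hsm hk H hH y c h'⟩

/-- ★★★ **THE SUPPORT CLAUSE (gN4) AT A GUARDED BACKGROUND**: for chart data `y` vanishing on the level-0 rows, every right inverse `H` of `DΦ_U(0)` at `𝐁_k(Z)` has
`(H y)(c) ≠ 0 ⟹ c₋ ∈ Ω₁ ∧ c₊ ∈ Ω₁`. [cite: Balaban1988Convergent, (2.2) p.255, (2.11) p.256, (2.13) pp.256-257] -/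
theorem guardedChartRightInverse_support_Bj {t₀ : ℝ} (ht₀ : 0 < t₀) (hstδ : stokesConst (F.P K) * t₀ < deltaSU (Fin N))
    {U : GaugeField (F.P K) 0 (SU N)} (hsm : ∀ i, i < k → PlaqSmall t₀ (Averaging.iter (avOfRecord F N K) i U))
    {M₁ : ℕ} (hk : 0 < k) {Z : Set (Site (F.P K) 0)}
    (H : (Fin (constrCard (Bj M₁ Z k : DetSet (F.P K)) k) → lieSU (Fin N)) → PBond (F.P K) 0 → lieSU (Fin N))
    (hH : ∀ y, fderiv ℝ (msChart F N K k (Bj M₁ Z k) (avgFamily (avOfRecord F N K) U) U) 0 (H y) = y)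
    (y : Fin (constrCard (Bj M₁ Z k : DetSet (F.P K)) k) → lieSU (Fin N))
    (hy0 : ∀ (c : PBond (F.P K) 0) (hc : c ∈ bondsOf ((Bj M₁ Z k : DetSet (F.P K)) 0)), y (constrEnum (Bj M₁ Z k : DetSet (F.P K)) k ⟨⟨0, Nat.succ_pos k⟩, c, hc⟩) = 0)
    (c : PBond (F.P K) 0) (hc : H y c ≠ 0) : c.src ∈ maxDomT M₁ Z 1 ∧ c.tgt ∈ maxDomT M₁ Z 1 := by
  by_contra h
  have h' : c.src ∉ maxDomT M₁ Z 1 ∨ c.tgt ∉ maxDomT M₁ Z 1 := by tauto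
  exact hc ((guardedChartRightInverse_apply_off_Bj ht₀ hstδ hsm hk H hH y c h').trans (hy0 c _))

end GuardedChartShape

end Summit.QuantumFields.YangMills.BalabanUVNodes.N12RightInverseLevelZeroLocality
end
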